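import Literature.MathematicalPhysics.QuantumFieldTheory.Balaban1983to89.B3Ineq211RegularBox

/-!
# Bałaban, *(Higgs)₂,₃ quantum fields in a finite volume III* [B3] — the ROWS / COLUMNS of the propagator `G_k(Ω,X)` ON A CELL-PRODUCT
# BOX OF BIG BLOCKS in the scale-majorant currency of the (1.16)/(2.5) kernel bookkeeping (`B3Op116ScaleChains.bond_chain3_le`):
# value column (exponent 2), differentiated column (exponent 1), Hölder-transported differentiated column (exponent `1 − α`, two anchors)
# — PROVED from this seat's `R₀`-free box members of (2.10)/(2.11) and the resummation (2.6)

statement-level skeleton of published theorems with citation tags; proofs where landed; nothing here is a claim about the Yang–Mills mass gap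

T. Bałaban, Commun. Math. Phys. **88** (1983) 411–445 [cite: Balaban1983Higgs3] ((1.16) p. 414, (2.5)–(2.6) p. 424, (2.10)–(2.11) p. 426);
part I [cite: Balaban1982Higgs1] (Prop. 2.1 p. 610, p. 611 l.1–2).  PDF held: `paper:balaban1983-higgs-2-3-quantum-fields-finite-volume` pp. 414,
424, 426 [PDF 4, 14, 16].

CITATION HEADER (lean-in-tree rule).  Cell `lit-balaban`, Phase-2 proof seat **p35** gen 21 (unit `lit-balaban-p35`).  Rows **B3.Eq1.16** /
**B3.Eq2.5** (r14's (1.16) analytic-half programme, `lit-balaban-r14/DESIGN-B3-116-analytic.md` §4; FILE 3(b)(v) box step and FILE 4 = p35's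
derivative/Hölder clauses) — SUPPORT LEMMAS (the «dictionary» from kernel estimates to chain majorants), located under B3.Eq2.10/B3.Eq2.11 as
consumers; no head claim.  USED BY NAME, never restated: r14 g17's region pieces and the (2.6) resummation `B3Ineq210RegularRegion.{pieceR,
sum_pieceR}`, this seat's box members `B3Ineq210RegularBox.ineq210_regularBox_explicit_small` ((2.10), every pair of points / every bond of the
box) and `B3Ineq211RegularBox.ineq211At_regularBox_explicit_small` ((2.11), every pair of bonds, contour inside the box), `holderTermR`, `IsAdm`,
the holonomy `hol`.  The torus/region twins of §1 are r14's `B3Op116KernelRegularTorus.col_le_of_ineq210`/`dcol_le_of_ineq210` (carrier form,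
interior points); the lemmas here take the per-piece bounds as HYPOTHESES at the given pair of arguments (any region `Ω`), so they serve boxes
(no carrier of r14's type) and any other member stated in print's units.

## What is printed

[B3] p. 424 (2.6): *«G^η_k(Ω, B̃) = Σ_{j=0}^{k−1} G^η_{(j)}(Ω, B̃)»* (resummed in the tree as `sum_pieceR`); p. 426 (2.10)–(2.11) per piece; p. 414
(1.16): the kernel bounds are assembled from chains of such columns (r14's FILE E `bond_chain3_le` consumes majorants of the form
`F(b) ≤ Σ_{j<k} c·(L^jε)^{a−d}·e^{−δ(L^jε)^{−1}ε|x − b₋|}`).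

## What this file proves

§1 (any region `Ω`, hypotheses = per-piece bounds at the arguments): `col_le_of_pieces` (a = 2), `dcol_le_of_pieces` (a = 1),
`hcol_le_of_pieces` (the Hölder-transported differentiated column over an admissible contour, divided by `(ε|x₁−x₂|)^α`: a = 1 − α, the
two-point profile `e^{−δ·min(|x₁−y|,|x₂−y|)}` majorised by the SUM of the two one-anchor profiles).  §2 (boxes `Ω = cellBox k K₀ S`, every
point / bond / pair of bonds of the box, one smallness parameter, every charge): `colB_le`, `dcolB_le` (from `ineq210_regularBox_explicit_small`),
`hcolB_le` (from `ineq211At_regularBox_explicit_small`).  §3 (v1.1, APPEND-ONLY, p35 gen 21: the TORUS twin for FILE 4's Hölder row)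
`hcol_le_univ`: the same Hölder-transported differentiated column for `Ω = T_ε` at EVERY pair of points (this seat's
`B3Ineq211RegularRegion.ineq211At_regularRegion_small_explicit` + `interior_univ` through `hcol_le_of_pieces`).  §4 (v1.2, APPEND-ONLY,
p35 gen 23: the REGION twin for the region programme of B3-CLOSURE §5 item 20) `hcol_le_region`: the same on every big-block union `Ω ⊆ T_ε`
at INTERIOR `x₁, x₂, y` (`B3Ineq210RegularRegion.Interior`), directly from `ineq211At_regularRegion_small_explicit` + `hcol_le_of_pieces`.

## Honest scope

Pure repackaging: (2.6) + triangle inequality + the landed box members; the F-currency is r14's (`Finset.range k` sums, constant `ε^d·C`,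
anchor at the row point).  Nothing about the (1.16) kernel itself is claimed here.  No `def`, no `def … : Prop`, no new named fact; axioms standard.
-/

noncomputable section

open scoped BigOperators

namespace Literature.MathematicalPhysics.QuantumFieldTheory.Balaban1983to89.B3Op116BoxRows

open HiggsLattice (ChargeData ScalarField covDeriv)
open HiggsCovariance (propagatorK)
open B1Eq230FluctCov (Ix cb)
open B1TorusChainTransport (hol)
open B1TorusCubeCover (half)
open B3Ineq210RegularTorus (covDeriv_sum'')
open B3Ineq210RegularRegion (pieceR sum_pieceR)
open B3Ineq211RegularTorus (IsAdm)
open B3Ineq211RegularRegion (holderTermR interior_univ ineq211At_regularRegion_small_explicit)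
open B1TorusRegionHSizes (isBigBlockUnion_univ)
open B1Ineq225RegularBox (cellBox)
open B3Ineq210RegularBox (ineq210_regularBox_explicit_small)
open B3Ineq211RegularBox (ineq211At_regularBox_explicit_small)

variable {P : HiggsLattice.Params} {N : ℕ}

/-! ## §1 From per-piece bounds to chain majorants (any region) -/

section OfPieces

variable {C : ChargeData N} {Ω : Finset (HiggsLattice.Site P 0)} {X : HiggsLattice.VecField P 0} {msq a : ℝ} {k : ℕ}
  {δ₁ Cst : ℝ}

/-- **Value column**: if every piece satisfies (2.10) at `(x, y)` in print's units, then
`Σ_i‖(G_k(Ω,X)e_{(y,i)})(x)‖ ≤ Σ_{j<k} ε^dC·(L^jε)^{2−d}e^{−δ₁(L^jε)^{−1}ε|x−y|}`. [cite: Balaban1983Higgs3, (2.6) p.424, (2.10) p.426] -/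
theorem col_le_of_pieces (hmsq : 0 < msq) (ha : 0 < a) (hL1 : 1 < P.L) (hk : 1 ≤ k) (hkK : k ≤ P.K)
    {x y : HiggsLattice.Site P 0}
    (hv : ∀ j : ℕ, (P.mesh 0 ^ P.d)⁻¹ * ∑ i : Ix N, ‖pieceR C Ω X msq a k j (cb P N 0 (y, i)) x‖
      ≤ Cst * P.mesh j ^ ((2 : ℝ) - (P.d : ℝ)) * Real.exp (-(δ₁ * (P.mesh j)⁻¹ * (P.mesh 0 * (HiggsLattice.Site.tdist x y : ℝ))))) :
    ∑ i : Ix N, ‖propagatorK C Ω X msq a k (cb P N 0 (y, i)) x‖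
      ≤ ∑ j ∈ Finset.range k, (P.mesh 0 ^ P.d * Cst) * P.mesh j ^ ((2 : ℝ) - (P.d : ℝ)) *
          Real.exp (-(δ₁ * (P.mesh j)⁻¹ * (P.mesh 0 * (HiggsLattice.Site.tdist x y : ℝ)))) := by
  have hm : 0 < P.mesh 0 ^ P.d := pow_pos (P.mesh_pos 0) _
  rw [← sum_pieceR (C := C) (Ω := Ω) (A := X) (a := a) hmsq ha hL1 hk hkK]
  calc ∑ i : Ix N, ‖(∑ j ∈ Finset.range k, pieceR C Ω X msq a k j) (cb P N 0 (y, i)) x‖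
      = ∑ i : Ix N, ‖∑ j ∈ Finset.range k, pieceR C Ω X msq a k j (cb P N 0 (y, i)) x‖ := by
        refine Finset.sum_congr rfl fun i _ => ?_
        rw [LinearMap.sum_apply, Finset.sum_apply]
    _ ≤ ∑ i : Ix N, ∑ j ∈ Finset.range k, ‖pieceR C Ω X msq a k j (cb P N 0 (y, i)) x‖ :=
        Finset.sum_le_sum fun i _ => norm_sum_le _ _
    _ = ∑ j ∈ Finset.range k, ∑ i : Ix N, ‖pieceR C Ω X msq a k j (cb P N 0 (y, i)) x‖ := Finset.sum_comm
    _ ≤ _ := Finset.sum_le_sum fun j _ => ?_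
  have h := hv j
  rw [inv_mul_le_iff₀ hm] at h
  calc ∑ i : Ix N, ‖pieceR C Ω X msq a k j (cb P N 0 (y, i)) x‖
      ≤ P.mesh 0 ^ P.d * (Cst * P.mesh j ^ ((2 : ℝ) - (P.d : ℝ)) *
          Real.exp (-(δ₁ * (P.mesh j)⁻¹ * (P.mesh 0 * (HiggsLattice.Site.tdist x y : ℝ))))) := h
    _ = _ := by ring

/-- **Differentiated column**: if every piece satisfies the differentiated (2.10) at the bond `b` and the source `y`, then
`Σ_i‖(D^ε_XG_k(Ω,X)e_{(y,i)})(b)‖ ≤ Σ_{j<k} ε^dC·(L^jε)^{1−d}e^{−δ₁(L^jε)^{−1}ε|b₋−y|}`. [cite: Balaban1983Higgs3, (2.6) p.424, (2.10) p.426] -/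
theorem dcol_le_of_pieces (hmsq : 0 < msq) (ha : 0 < a) (hL1 : 1 < P.L) (hk : 1 ≤ k) (hkK : k ≤ P.K)
    {b : HiggsLattice.PBond P 0} {y : HiggsLattice.Site P 0}
    (hd : ∀ j : ℕ, (P.mesh 0 ^ P.d)⁻¹ * ∑ i : Ix N, ‖covDeriv C X (pieceR C Ω X msq a k j (cb P N 0 (y, i))) b‖
      ≤ Cst * P.mesh j ^ ((1 : ℝ) - (P.d : ℝ)) *
        Real.exp (-(δ₁ * (P.mesh j)⁻¹ * (P.mesh 0 * (HiggsLattice.Site.tdist b.src y : ℝ))))) :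
    ∑ i : Ix N, ‖covDeriv C X (propagatorK C Ω X msq a k (cb P N 0 (y, i))) b‖
      ≤ ∑ j ∈ Finset.range k, (P.mesh 0 ^ P.d * Cst) * P.mesh j ^ ((1 : ℝ) - (P.d : ℝ)) *
          Real.exp (-(δ₁ * (P.mesh j)⁻¹ * (P.mesh 0 * (HiggsLattice.Site.tdist b.src y : ℝ)))) := by
  have hm : 0 < P.mesh 0 ^ P.d := pow_pos (P.mesh_pos 0) _
  rw [← sum_pieceR (C := C) (Ω := Ω) (A := X) (a := a) hmsq ha hL1 hk hkK]
  calc ∑ i : Ix N, ‖covDeriv C X ((∑ j ∈ Finset.range k, pieceR C Ω X msq a k j) (cb P N 0 (y, i))) b‖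
      = ∑ i : Ix N, ‖∑ j ∈ Finset.range k, covDeriv C X (pieceR C Ω X msq a k j (cb P N 0 (y, i))) b‖ := by
        refine Finset.sum_congr rfl fun i _ => ?_
        rw [LinearMap.sum_apply, covDeriv_sum'']
    _ ≤ ∑ i : Ix N, ∑ j ∈ Finset.range k, ‖covDeriv C X (pieceR C Ω X msq a k j (cb P N 0 (y, i))) b‖ :=
        Finset.sum_le_sum fun i _ => norm_sum_le _ _
    _ = ∑ j ∈ Finset.range k, ∑ i : Ix N, ‖covDeriv C X (pieceR C Ω X msq a k j (cb P N 0 (y, i))) b‖ := Finset.sum_comm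
    _ ≤ _ := Finset.sum_le_sum fun j _ => ?_
  have h := hd j
  rw [inv_mul_le_iff₀ hm] at h
  calc ∑ i : Ix N, ‖covDeriv C X (pieceR C Ω X msq a k j (cb P N 0 (y, i))) b‖
      ≤ P.mesh 0 ^ P.d * (Cst * P.mesh j ^ ((1 : ℝ) - (P.d : ℝ)) *
          Real.exp (-(δ₁ * (P.mesh j)⁻¹ * (P.mesh 0 * (HiggsLattice.Site.tdist b.src y : ℝ))))) := h
    _ = _ := by ring

/-- `e^{−c·min(u,v)} ≤ e^{−cu} + e^{−cv}`: the two-point profile of (2.11) under the two one-anchor profiles. [folklore] -/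
private theorem exp_min_le_add (c u v : ℝ) :
    Real.exp (-(c * min u v)) ≤ Real.exp (-(c * u)) + Real.exp (-(c * v)) := by
  rcases min_choice u v with h | h <;> rw [h]
  · exact le_add_of_nonneg_right (Real.exp_pos _).le
  · exact le_add_of_nonneg_left (Real.exp_pos _).le

/-- **Hölder-transported differentiated column** (two anchors): if every piece satisfies (2.11) at the bonds `⟨x₁,x₁+εe_μ⟩, ⟨x₂,x₂+εe_μ⟩`,
the contour `Γ` and the source `y` in print's units, then
`Σ_i‖U(X(Γ))(D^ε_XG_k(Ω,X)e_{(y,i)})(⟨x₂,μ⟩) − (D^ε_XG_k(Ω,X)e_{(y,i)})(⟨x₁,μ⟩)‖/(ε|x₁−x₂|)^α ≤ Σ_{j<k} ε^dC·(L^jε)^{(1−α)−d}·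
(e^{−δ₁(L^jε)^{−1}ε|x₁−y|} + e^{−δ₁(L^jε)^{−1}ε|x₂−y|})` — exponent `a = 1 − α` in the currency of `bond_chain3_le`, one majorant per anchor.
[cite: Balaban1983Higgs3, (2.6) p.424, (2.11) p.426, (1.16) p.414] -/
theorem hcol_le_of_pieces (hmsq : 0 < msq) (ha : 0 < a) (hL1 : 1 < P.L) (hk : 1 ≤ k) (hkK : k ≤ P.K) (hCst : 0 ≤ Cst)
    {α : ℝ} {μ : Fin P.d} {x₁ x₂ y : HiggsLattice.Site P 0} {Γ : List (HiggsLattice.Site P 0)}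
    (hH : ∀ j : ℕ, holderTermR C Ω X msq a k j μ x₁ x₂ y Γ / (P.mesh 0 * (HiggsLattice.Site.tdist x₁ x₂ : ℝ)) ^ α
      ≤ Cst * P.mesh j ^ ((1 : ℝ) - (P.d : ℝ) - α) *
        Real.exp (-(δ₁ * (P.mesh j)⁻¹ *
          (P.mesh 0 * min (HiggsLattice.Site.tdist x₁ y : ℝ) (HiggsLattice.Site.tdist x₂ y : ℝ))))) :
    (∑ i : Ix N, ‖hol C X x₁ Γ (covDeriv C X (propagatorK C Ω X msq a k (cb P N 0 (y, i))) ⟨x₂, μ⟩)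
        - covDeriv C X (propagatorK C Ω X msq a k (cb P N 0 (y, i))) ⟨x₁, μ⟩‖)
        / (P.mesh 0 * (HiggsLattice.Site.tdist x₁ x₂ : ℝ)) ^ α
      ≤ ∑ j ∈ Finset.range k, (P.mesh 0 ^ P.d * Cst) * P.mesh j ^ (((1 : ℝ) - α) - (P.d : ℝ)) *
          (Real.exp (-(δ₁ * (P.mesh j)⁻¹ * (P.mesh 0 * (HiggsLattice.Site.tdist x₁ y : ℝ)))) +
            Real.exp (-(δ₁ * (P.mesh j)⁻¹ * (P.mesh 0 * (HiggsLattice.Site.tdist x₂ y : ℝ))))) := by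
  have hm : 0 < P.mesh 0 ^ P.d := pow_pos (P.mesh_pos 0) _
  have hW : 0 ≤ (P.mesh 0 * (HiggsLattice.Site.tdist x₁ x₂ : ℝ)) ^ α :=
    Real.rpow_nonneg (mul_nonneg (P.mesh_pos 0).le (Nat.cast_nonneg _)) _
  -- (2.6): split the propagator into its pieces inside the transported difference
  have hsplit : ∀ i : Ix N,
      hol C X x₁ Γ (covDeriv C X (propagatorK C Ω X msq a k (cb P N 0 (y, i))) ⟨x₂, μ⟩)
          - covDeriv C X (propagatorK C Ω X msq a k (cb P N 0 (y, i))) ⟨x₁, μ⟩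
        = ∑ j ∈ Finset.range k, (hol C X x₁ Γ (covDeriv C X (pieceR C Ω X msq a k j (cb P N 0 (y, i))) ⟨x₂, μ⟩)
            - covDeriv C X (pieceR C Ω X msq a k j (cb P N 0 (y, i))) ⟨x₁, μ⟩) := by
    intro i
    rw [← sum_pieceR (C := C) (Ω := Ω) (A := X) (a := a) hmsq ha hL1 hk hkK, LinearMap.sum_apply, covDeriv_sum'', covDeriv_sum'',
      map_sum, ← Finset.sum_sub_distrib]
  have hstep : ∑ i : Ix N, ‖hol C X x₁ Γ (covDeriv C X (propagatorK C Ω X msq a k (cb P N 0 (y, i))) ⟨x₂, μ⟩)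
        - covDeriv C X (propagatorK C Ω X msq a k (cb P N 0 (y, i))) ⟨x₁, μ⟩‖
      ≤ ∑ j ∈ Finset.range k, P.mesh 0 ^ P.d * holderTermR C Ω X msq a k j μ x₁ x₂ y Γ := by
    calc ∑ i : Ix N, ‖hol C X x₁ Γ (covDeriv C X (propagatorK C Ω X msq a k (cb P N 0 (y, i))) ⟨x₂, μ⟩)
          - covDeriv C X (propagatorK C Ω X msq a k (cb P N 0 (y, i))) ⟨x₁, μ⟩‖
        ≤ ∑ i : Ix N, ∑ j ∈ Finset.range k, ‖hol C X x₁ Γ (covDeriv C X (pieceR C Ω X msq a k j (cb P N 0 (y, i))) ⟨x₂, μ⟩)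
            - covDeriv C X (pieceR C Ω X msq a k j (cb P N 0 (y, i))) ⟨x₁, μ⟩‖ :=
          Finset.sum_le_sum fun i _ => by rw [hsplit i]; exact norm_sum_le _ _
      _ = ∑ j ∈ Finset.range k, ∑ i : Ix N, ‖hol C X x₁ Γ (covDeriv C X (pieceR C Ω X msq a k j (cb P N 0 (y, i))) ⟨x₂, μ⟩)
            - covDeriv C X (pieceR C Ω X msq a k j (cb P N 0 (y, i))) ⟨x₁, μ⟩‖ := Finset.sum_comm
      _ = _ := by
          refine Finset.sum_congr rfl fun j _ => ?_
          unfold holderTermR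
          rw [← mul_assoc, mul_inv_cancel₀ hm.ne', one_mul]
  rw [div_eq_mul_inv]
  refine (mul_le_mul_of_nonneg_right hstep (inv_nonneg.mpr hW)).trans ?_
  rw [Finset.sum_mul]
  refine Finset.sum_le_sum fun j _ => ?_
  have hmj : 0 < P.mesh j := P.mesh_pos j
  have h := hH j
  rw [div_eq_mul_inv] at h
  have h2 := exp_min_le_add (δ₁ * (P.mesh j)⁻¹) (P.mesh 0 * (HiggsLattice.Site.tdist x₁ y : ℝ))
    (P.mesh 0 * (HiggsLattice.Site.tdist x₂ y : ℝ))
  rw [← mul_min_of_nonneg _ _ (P.mesh_pos 0).le] at h2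
  have hexp : (1 : ℝ) - (P.d : ℝ) - α = ((1 : ℝ) - α) - (P.d : ℝ) := by ring
  rw [hexp] at h
  have hC : 0 ≤ Cst * P.mesh j ^ (((1 : ℝ) - α) - (P.d : ℝ)) := mul_nonneg hCst (Real.rpow_nonneg hmj.le _)
  calc P.mesh 0 ^ P.d * holderTermR C Ω X msq a k j μ x₁ x₂ y Γ * ((P.mesh 0 * (HiggsLattice.Site.tdist x₁ x₂ : ℝ)) ^ α)⁻¹
      = P.mesh 0 ^ P.d * (holderTermR C Ω X msq a k j μ x₁ x₂ y Γ * ((P.mesh 0 * (HiggsLattice.Site.tdist x₁ x₂ : ℝ)) ^ α)⁻¹) := by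
        ring
    _ ≤ P.mesh 0 ^ P.d * (Cst * P.mesh j ^ (((1 : ℝ) - α) - (P.d : ℝ)) *
          Real.exp (-(δ₁ * (P.mesh j)⁻¹ *
            (P.mesh 0 * min (HiggsLattice.Site.tdist x₁ y : ℝ) (HiggsLattice.Site.tdist x₂ y : ℝ))))) :=
        mul_le_mul_of_nonneg_left h hm.le
    _ ≤ P.mesh 0 ^ P.d * (Cst * P.mesh j ^ (((1 : ℝ) - α) - (P.d : ℝ)) *
          (Real.exp (-(δ₁ * (P.mesh j)⁻¹ * (P.mesh 0 * (HiggsLattice.Site.tdist x₁ y : ℝ)))) +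
            Real.exp (-(δ₁ * (P.mesh j)⁻¹ * (P.mesh 0 * (HiggsLattice.Site.tdist x₂ y : ℝ)))))) :=
        mul_le_mul_of_nonneg_left (mul_le_mul_of_nonneg_left h2 hC) hm.le
    _ = _ := by ring

end OfPieces

/-! ## §2 The box rows: `Ω = cellBox k K₀ S`, every point / bond / pair of bonds of the box -/

section BoxRows

/-- **Value and differentiated columns of `G_k(Ω,X)` on a cell-product box**, F-currency, at EVERY `x, y ∈ Ω` resp. every bond
`⟨x, x+εe_μ⟩ ⊂ Ω`: for `d ≥ 1`, `L ≥ 2`, `a, m² > 0`, `N`, every charge: ∃ `K₀,min`, ∀ `K₀ ≥ K₀,min` ∃ `t, δ₁, C > 0` such that for every volume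
with these `d, L`, `K₀ ∣ M`, every `1 ≤ k ≤ K` with `L^kε ≤ 1`, `3L^kK₀ ≤ |T_ε|_μ`, every `S` and every `X` `δ`-regular on `Ω` with `L^kδ|e| ≤ t`:
`Σ_i‖(G_k(Ω,X)e_{(y,i)})(x)‖ ≤ Σ_{j<k} ε^dC(L^jε)^{2−d}e^{−δ₁(L^jε)^{−1}ε|x−y|}` and, when `x + εe_μ ∈ Ω`,
`Σ_i‖(D^ε_XG_k(Ω,X)e_{(y,i)})(⟨x,μ⟩)‖ ≤ Σ_{j<k} ε^dC(L^jε)^{1−d}e^{−δ₁(L^jε)^{−1}ε|x−y|}` (`ineq210_regularBox_explicit_small` + §1).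
[cite: Balaban1983Higgs3, (2.6) p.424, (2.10) p.426, (1.16) p.414] [cite: Balaban1982Higgs1, Prop. 2.1 p.610, p.611 l.1–2] -/
theorem colB_dcolB_le (d L : ℕ) (hd : 1 ≤ d) (hL : 2 ≤ L) {a : ℝ} (ha : 0 < a) {msq : ℝ} (hmsq : 0 < msq) (N : ℕ) (C : ChargeData N) :
    ∃ K₀min : ℕ, ∀ K₀ : ℕ, K₀min ≤ K₀ → ∃ t δ₁ Cst : ℝ, 0 < t ∧ 0 < δ₁ ∧ 0 < Cst ∧
      ∀ (P : HiggsLattice.Params), 1 < P.L → P.d = d → P.L = L → K₀ ∣ P.M →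
      ∀ {k : ℕ}, 1 ≤ k → k ≤ P.K → (∀ μ, 3 * half P k K₀ ≤ P.sitesPerDir 0 μ) → P.mesh k ≤ 1 →
      ∀ (S : Fin P.d → Finset ℕ) (X : HiggsLattice.VecField P 0) {δA : ℝ}, 0 ≤ δA →
        (∀ z ∈ cellBox k K₀ S, ∀ μ ν : Fin P.d, |X ⟨z.shift ν, μ⟩ - X ⟨z, μ⟩| ≤ δA) →
        (P.L : ℝ) ^ k * δA * |C.e| ≤ t →
        ∀ (x y : HiggsLattice.Site P 0), x ∈ cellBox k K₀ S → y ∈ cellBox k K₀ S →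
          (∑ i : Ix N, ‖propagatorK C (cellBox k K₀ S) X msq a k (cb P N 0 (y, i)) x‖
              ≤ ∑ j ∈ Finset.range k, (P.mesh 0 ^ P.d * Cst) * P.mesh j ^ ((2 : ℝ) - (P.d : ℝ)) *
                  Real.exp (-(δ₁ * (P.mesh j)⁻¹ * (P.mesh 0 * (HiggsLattice.Site.tdist x y : ℝ))))) ∧
          ∀ μ : Fin P.d, x.shift μ ∈ cellBox k K₀ S →
            ∑ i : Ix N, ‖covDeriv C X (propagatorK C (cellBox k K₀ S) X msq a k (cb P N 0 (y, i))) ⟨x, μ⟩‖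
              ≤ ∑ j ∈ Finset.range k, (P.mesh 0 ^ P.d * Cst) * P.mesh j ^ ((1 : ℝ) - (P.d : ℝ)) *
                  Real.exp (-(δ₁ * (P.mesh j)⁻¹ * (P.mesh 0 * (HiggsLattice.Site.tdist x y : ℝ)))) := by
  obtain ⟨K₀min, h⟩ := ineq210_regularBox_explicit_small d L hd hL ha hmsq N C
  refine ⟨K₀min, fun K₀ hK₀ => ?_⟩
  obtain ⟨t, δ₁, Cst, ht, hδ₁, hCst, h⟩ := h K₀ hK₀
  refine ⟨t, δ₁, Cst, ht, hδ₁, hCst, ?_⟩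
  intro P hP1 hPd hPL hK₀M k hk1 hkK h3 hmesh S X δA hδA hreg ht' x y hx hy
  have hh := fun j => h P hP1 hPd hPL hK₀M hk1 hkK h3 hmesh S X hδA hreg ht' j x y hx hy
  refine ⟨col_le_of_pieces hmsq ha hP1 hk1 hkK (fun j => (hh j).1), fun μ hμ => ?_⟩
  exact dcol_le_of_pieces (b := ⟨x, μ⟩) hmsq ha hP1 hk1 hkK (fun j => (hh j).2 μ hμ)

/-- **Hölder-transported differentiated column of `G_k(Ω,X)` on a cell-product box**, F-currency with exponent `1 − α` and two anchors, at
EVERY pair of bonds `⟨x₁,x₁+εe_μ⟩, ⟨x₂,x₂+εe_μ⟩ ⊂ Ω` (`x₁ ≠ x₂`), every admissible contour `Γ ⊂ Ω` and every source `y ∈ Ω`: ∃ `K₀,min`, ∀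
`0 ≤ α < 1`, ∀ `K₀ ≥ K₀,min` ∃ `t, δ₁, C > 0` with, under the hypotheses of `colB_dcolB_le`,
`Σ_i‖U(X(Γ))(D^ε_XG_k e_{(y,i)})(⟨x₂,μ⟩) − (D^ε_XG_k e_{(y,i)})(⟨x₁,μ⟩)‖/(ε|x₁−x₂|)^α ≤ Σ_{j<k} ε^dC(L^jε)^{(1−α)−d}(e^{−δ₁(L^jε)^{−1}ε|x₁−y|} +
e^{−δ₁(L^jε)^{−1}ε|x₂−y|})` (`ineq211At_regularBox_explicit_small` + §1).
[cite: Balaban1983Higgs3, (2.6) p.424, (2.11) p.426, (1.16) p.414] [cite: Balaban1982Higgs1, Prop. 2.1 (2.24) p.610, p.611 l.1–2] -/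
theorem hcolB_le (d L : ℕ) (hd : 1 ≤ d) (hL : 2 ≤ L) {a : ℝ} (ha : 0 < a) {msq : ℝ} (hmsq : 0 < msq) (N : ℕ) (C : ChargeData N) :
    ∃ K₀min : ℕ, ∀ {α : ℝ}, 0 ≤ α → α < 1 → ∀ K₀ : ℕ, K₀min ≤ K₀ → ∃ t δ₁ Cst : ℝ, 0 < t ∧ 0 < δ₁ ∧ 0 < Cst ∧
      ∀ (P : HiggsLattice.Params), 1 < P.L → P.d = d → P.L = L → K₀ ∣ P.M →
      ∀ {k : ℕ}, 1 ≤ k → k ≤ P.K → (∀ μ, 3 * half P k K₀ ≤ P.sitesPerDir 0 μ) → P.mesh k ≤ 1 →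
      ∀ (S : Fin P.d → Finset ℕ) (X : HiggsLattice.VecField P 0) {δA : ℝ}, 0 ≤ δA →
        (∀ z ∈ cellBox k K₀ S, ∀ μ ν : Fin P.d, |X ⟨z.shift ν, μ⟩ - X ⟨z, μ⟩| ≤ δA) →
        (P.L : ℝ) ^ k * δA * |C.e| ≤ t →
        ∀ (μ : Fin P.d) (x₁ x₂ y : HiggsLattice.Site P 0), x₂ ≠ x₁ →
          x₁ ∈ cellBox k K₀ S → x₁.shift μ ∈ cellBox k K₀ S → x₂ ∈ cellBox k K₀ S → x₂.shift μ ∈ cellBox k K₀ S →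
          y ∈ cellBox k K₀ S → ∀ Γ : List (HiggsLattice.Site P 0), IsAdm x₁ x₂ Γ → (∀ z ∈ Γ, z ∈ cellBox k K₀ S) →
          (∑ i : Ix N, ‖hol C X x₁ Γ (covDeriv C X (propagatorK C (cellBox k K₀ S) X msq a k (cb P N 0 (y, i))) ⟨x₂, μ⟩)
              - covDeriv C X (propagatorK C (cellBox k K₀ S) X msq a k (cb P N 0 (y, i))) ⟨x₁, μ⟩‖)
              / (P.mesh 0 * (HiggsLattice.Site.tdist x₁ x₂ : ℝ)) ^ α
            ≤ ∑ j ∈ Finset.range k, (P.mesh 0 ^ P.d * Cst) * P.mesh j ^ (((1 : ℝ) - α) - (P.d : ℝ)) *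
                (Real.exp (-(δ₁ * (P.mesh j)⁻¹ * (P.mesh 0 * (HiggsLattice.Site.tdist x₁ y : ℝ)))) +
                  Real.exp (-(δ₁ * (P.mesh j)⁻¹ * (P.mesh 0 * (HiggsLattice.Site.tdist x₂ y : ℝ))))) := by
  obtain ⟨K₀min, h⟩ := ineq211At_regularBox_explicit_small d L hd hL ha hmsq N C
  refine ⟨K₀min, fun {α} hα0 hα1 K₀ hK₀ => ?_⟩
  obtain ⟨t, δ₁, Cst, ht, hδ₁, hCst, h⟩ := h hα0 hα1 K₀ hK₀
  refine ⟨t, δ₁, Cst, ht, hδ₁, hCst, ?_⟩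
  intro P hP1 hPd hPL hK₀M k hk1 hkK h3 hmesh S X δA hδA hreg ht' μ x₁ x₂ y hne hx₁ hx₁μ hx₂ hx₂μ hy Γ hΓ hΓΩ
  exact hcol_le_of_pieces hmsq ha hP1 hk1 hkK hCst.le
    (fun j => h P hPd hPL hK₀M hk1 hkK h3 hmesh S X hδA hreg ht' j μ x₁ x₂ y hne hx₁ hx₁μ hx₂ hx₂μ hy Γ hΓ hΓΩ)

end BoxRows

/-! ## §3 (v1.1) The torus Hölder row: `Ω = T_ε`, every pair of points -/

section TorusRow

/-- **Hölder-transported differentiated column of `G_k(T_ε,X)` ON THE WHOLE TORUS**, F-currency with exponent `1 − α` and two anchors, at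
EVERY `x₁ ≠ x₂`, every admissible contour `Γ` and every source `y` (v1.1): ∃ `K₀,min`, ∀ `0 ≤ α < 1`, ∀ `K₀ ≥ K₀,min` ∃ `t, δ₁, C > 0` with,
for every volume with these `d, L`, `K₀ ∣ M`, every `1 ≤ k ≤ K` with `L^kε ≤ 1`, `3L^kK₀ ≤ |T_ε|_μ`, and every `X` `δ`-regular on `T_ε` with
`L^kδ|e| ≤ t`:
`Σ_i‖U(X(Γ))(D^ε_XG_k e_{(y,i)})(⟨x₂,μ⟩) − (D^ε_XG_k e_{(y,i)})(⟨x₁,μ⟩)‖/(ε|x₁−x₂|)^α ≤ Σ_{j<k} ε^dC(L^jε)^{(1−α)−d}(e^{−δ₁(L^jε)^{−1}ε|x₁−y|} +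
e^{−δ₁(L^jε)^{−1}ε|x₂−y|})` — FILE 4's torus Hölder input in the currency of `bond_chain3_le` (this seat's region member at `Ω = T_ε`, where
every point is interior: `interior_univ`, `isBigBlockUnion_univ`).
[cite: Balaban1983Higgs3, (2.6) p.424, (2.11) p.426, (1.16) p.414] [cite: Balaban1982Higgs1, Prop. 2.1 (2.24) p.610, p.611] -/
theorem hcol_le_univ (d L : ℕ) (hd : 1 ≤ d) (hL : 2 ≤ L) {a : ℝ} (ha : 0 < a) {msq : ℝ} (hmsq : 0 < msq) (N : ℕ) (C : ChargeData N) :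
    ∃ K₀min : ℕ, ∀ {α : ℝ}, 0 ≤ α → α < 1 → ∀ K₀ : ℕ, K₀min ≤ K₀ → ∃ t δ₁ Cst : ℝ, 0 < t ∧ 0 < δ₁ ∧ 0 < Cst ∧
      ∀ (P : HiggsLattice.Params), 1 < P.L → P.d = d → P.L = L → K₀ ∣ P.M →
      ∀ {k : ℕ}, 1 ≤ k → k ≤ P.K → (∀ μ, 3 * half P k K₀ ≤ P.sitesPerDir 0 μ) → P.mesh k ≤ 1 →
      ∀ (X : HiggsLattice.VecField P 0) {δA : ℝ}, 0 ≤ δA →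
        (∀ (z : HiggsLattice.Site P 0) (μ ν : Fin P.d), |X ⟨z.shift ν, μ⟩ - X ⟨z, μ⟩| ≤ δA) →
        (P.L : ℝ) ^ k * δA * |C.e| ≤ t →
        ∀ (μ : Fin P.d) (x₁ x₂ y : HiggsLattice.Site P 0), x₁ ≠ x₂ → ∀ Γ : List (HiggsLattice.Site P 0), IsAdm x₁ x₂ Γ →
          (∑ i : Ix N, ‖hol C X x₁ Γ (covDeriv C X (propagatorK C Finset.univ X msq a k (cb P N 0 (y, i))) ⟨x₂, μ⟩)
              - covDeriv C X (propagatorK C Finset.univ X msq a k (cb P N 0 (y, i))) ⟨x₁, μ⟩‖)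
              / (P.mesh 0 * (HiggsLattice.Site.tdist x₁ x₂ : ℝ)) ^ α
            ≤ ∑ j ∈ Finset.range k, (P.mesh 0 ^ P.d * Cst) * P.mesh j ^ (((1 : ℝ) - α) - (P.d : ℝ)) *
                (Real.exp (-(δ₁ * (P.mesh j)⁻¹ * (P.mesh 0 * (HiggsLattice.Site.tdist x₁ y : ℝ)))) +
                  Real.exp (-(δ₁ * (P.mesh j)⁻¹ * (P.mesh 0 * (HiggsLattice.Site.tdist x₂ y : ℝ))))) := by
  obtain ⟨K₀min, h⟩ := ineq211At_regularRegion_small_explicit d L hd hL ha hmsq N C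
  refine ⟨K₀min, fun {α} hα0 hα1 K₀ hK₀ => ?_⟩
  obtain ⟨t, δ₁, Cst, ht, hδ₁, hCst, h⟩ := h hα0 hα1 K₀ hK₀
  refine ⟨t, δ₁, Cst, ht, hδ₁, hCst, ?_⟩
  intro P hP1 hPd hPL hK₀M k hk1 hkK h3 hmesh X δA hδA hreg ht' μ x₁ x₂ y hne Γ hΓ
  exact hcol_le_of_pieces hmsq ha hP1 hk1 hkK hCst.le
    (fun j => h P hP1 hPd hPL hK₀M hk1 hkK h3 hmesh Finset.univ isBigBlockUnion_univ X hδA (fun z _ μ' ν => hreg z μ' ν) ht'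
      j μ x₁ x₂ y (interior_univ k K₀ x₁) (interior_univ k K₀ x₂) (interior_univ k K₀ y) hne Γ hΓ)

end TorusRow

/-! ## §4 (v1.2, append-only) The REGION Hölder row: a big-block union `Ω ⊆ T_ε`, interior bonds and source

For the region twin of the (1.16) programme (B3-CLOSURE §5 item 20; p40 g75's `B3Op116RegionSources`/`…DKernelRegularRegion`, p35's
Hölder twin `B3Op116HolderKernelRegularRegion`): under [B3] p. 412's support hypothesis on `Ã` every kernel entry the chain reads has
interior arguments, so the (2.11) input is needed exactly at `Interior` points — this seat's `B3Ineq211RegularRegion.ineq211At_regularRegion_small_explicit`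
resummed by §1's `hcol_le_of_pieces` (general `Ω`). -/

section RegionRow

open B1TorusRegionHSizes (IsBigBlockUnion)
open B3Ineq210RegularRegion (Interior)

/-- **Hölder-transported differentiated column of `G_k(Ω,X)` ON A BIG-BLOCK UNION `Ω ⊆ T_ε` AT INTERIOR POINTS**, F-currency with exponent
`1 − α` and two anchors (v1.2): ∃ `K₀,min`, ∀ `0 ≤ α < 1`, ∀ `K₀ ≥ K₀,min` ∃ `t, δ₁, C > 0` with, for every volume with these `d, L`, `K₀ ∣ M`, every
`1 ≤ k ≤ K` with `L^kε ≤ 1`, `3L^kK₀ ≤ |T_ε|_μ`, every region `Ω` that is a union of big blocks, every `X` `δ`-regular on `Ω` with `L^kδ|e| ≤ t`,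
and all INTERIOR `x₁ ≠ x₂`, `y` (`Interior k K₀ Ω ·`: Prop. I.2.1's `R₀`-margin), every admissible contour `Γ`:
`Σ_i‖U(X(Γ))(D^ε_XG_k(Ω,X)e_{(y,i)})(⟨x₂,μ⟩) − (D^ε_XG_k(Ω,X)e_{(y,i)})(⟨x₁,μ⟩)‖/(ε|x₁−x₂|)^α ≤ Σ_{j<k} ε^dC(L^jε)^{(1−α)−d}(e^{−δ₁(L^jε)^{−1}ε|x₁−y|} +
e^{−δ₁(L^jε)^{−1}ε|x₂−y|})` — `ineq211At_regularRegion_small_explicit` + `hcol_le_of_pieces`; the torus row `hcol_le_univ` is its case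
`Ω = T_ε` (`interior_univ`). [cite: Balaban1983Higgs3, (2.6) p.424, (2.11) p.426, (1.16) p.414, p.412] [cite: Balaban1982Higgs1, Prop. 2.1 (2.24) p.610] -/
theorem hcol_le_region (d L : ℕ) (hd : 1 ≤ d) (hL : 2 ≤ L) {a : ℝ} (ha : 0 < a) {msq : ℝ} (hmsq : 0 < msq) (N : ℕ) (C : ChargeData N) :
    ∃ K₀min : ℕ, ∀ {α : ℝ}, 0 ≤ α → α < 1 → ∀ K₀ : ℕ, K₀min ≤ K₀ → ∃ t δ₁ Cst : ℝ, 0 < t ∧ 0 < δ₁ ∧ 0 < Cst ∧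
      ∀ (P : HiggsLattice.Params), 1 < P.L → P.d = d → P.L = L → K₀ ∣ P.M →
      ∀ {k : ℕ}, 1 ≤ k → k ≤ P.K → (∀ μ, 3 * half P k K₀ ≤ P.sitesPerDir 0 μ) → P.mesh k ≤ 1 →
      ∀ (Ω : Finset (HiggsLattice.Site P 0)), IsBigBlockUnion k K₀ Ω →
      ∀ (X : HiggsLattice.VecField P 0) {δA : ℝ}, 0 ≤ δA →
        (∀ z ∈ Ω, ∀ μ ν : Fin P.d, |X ⟨z.shift ν, μ⟩ - X ⟨z, μ⟩| ≤ δA) →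
        (P.L : ℝ) ^ k * δA * |C.e| ≤ t →
        ∀ (μ : Fin P.d) (x₁ x₂ y : HiggsLattice.Site P 0), Interior k K₀ Ω x₁ → Interior k K₀ Ω x₂ → Interior k K₀ Ω y →
          x₁ ≠ x₂ → ∀ Γ : List (HiggsLattice.Site P 0), IsAdm x₁ x₂ Γ →
          (∑ i : Ix N, ‖hol C X x₁ Γ (covDeriv C X (propagatorK C Ω X msq a k (cb P N 0 (y, i))) ⟨x₂, μ⟩)
              - covDeriv C X (propagatorK C Ω X msq a k (cb P N 0 (y, i))) ⟨x₁, μ⟩‖)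
              / (P.mesh 0 * (HiggsLattice.Site.tdist x₁ x₂ : ℝ)) ^ α
            ≤ ∑ j ∈ Finset.range k, (P.mesh 0 ^ P.d * Cst) * P.mesh j ^ (((1 : ℝ) - α) - (P.d : ℝ)) *
                (Real.exp (-(δ₁ * (P.mesh j)⁻¹ * (P.mesh 0 * (HiggsLattice.Site.tdist x₁ y : ℝ)))) +
                  Real.exp (-(δ₁ * (P.mesh j)⁻¹ * (P.mesh 0 * (HiggsLattice.Site.tdist x₂ y : ℝ))))) := by
  obtain ⟨K₀min, h⟩ := ineq211At_regularRegion_small_explicit d L hd hL ha hmsq N C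
  refine ⟨K₀min, fun {α} hα0 hα1 K₀ hK₀ => ?_⟩
  obtain ⟨t, δ₁, Cst, ht, hδ₁, hCst, h⟩ := h hα0 hα1 K₀ hK₀
  refine ⟨t, δ₁, Cst, ht, hδ₁, hCst, ?_⟩
  intro P hP1 hPd hPL hK₀M k hk1 hkK h3 hmesh Ω hΩ X δA hδA hreg ht' μ x₁ x₂ y hx₁ hx₂ hy hne Γ hΓ
  exact hcol_le_of_pieces hmsq ha hP1 hk1 hkK hCst.le
    (fun j => h P hP1 hPd hPL hK₀M hk1 hkK h3 hmesh Ω hΩ X hδA hreg ht' j μ x₁ x₂ y hx₁ hx₂ hy hne Γ hΓ)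

end RegionRow

end Literature.MathematicalPhysics.QuantumFieldTheory.Balaban1983to89.B3Op116BoxRows

end
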